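import Summits.QuantumFields.BalabanUV.Gaps.D1ReflectionSecondMoments
import Summits.QuantumFields.BalabanUV.Gaps.D1SymbolTraceGerm

/-!
# `BalabanUV.Gaps.D1SymbolPlueckerGerm` — cell pub-balaban-gaps, row (D1), seat g1-p1: (5.16) TO SECOND ORDER AS A LIMIT — under (5.7)–(5.9) + summable third moments, for every real `v` and
# direction `k`, `(Σ_z (Σ_{μν} v_μ v_ν P_{μν}(z)) cos(p k·z)) ∕ p² → ½ Σ_{μ≠ν} β_{μν} (v_μ k_ν − v_ν k_μ)²` (`p → 0`); near-zero-momentum positivity of the real symbol form forces all six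
# `β_{ab} ≥ 0`; hypothesis-free at an2's chart-(II) literal `JsRowD1Pin`, under the END's two symmetry binders `hW_j ∧ hR_j` at the pinned ∕ (III′) literals

HONEST FRAMING (cell rule, page 1 of everything): [folklore] composition BY NAME of row 97's general germ (`D1SymbolTraceGerm.tendsto_form_cos_div_sq`) with row 98's closed form
(`D1ReflectionSecondMoments.germ_eq_pluecker ∕ germ_nonneg_iff`), row 95's `re_symbolEntry_eq_tsum_cos`, an2's `symmetries_JsRowD1Pin`, GEN 14's dictionaries.  (5.16) p. 293 [Balaban1987RG1] is PRINTED for Bałaban's Π and NOT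
used (its second-order content is what is PROVED here for abstract kernels, with the matrix `β_{μν}` in place of the single `β` — no (1.21)).  NOTHING of Bałaban's is asserted; no symbol is
computed or certified; hW ∕ hR at the pinned ∕ (III′) literals REMAIN hypotheses; NO coefficient of Bałaban's computed or signed; (D1) NOT discharged; 0∕4 row-D1 binders at the pinned ∕ (III′)
literals; NOT `BetaPertH`, NOT continuum, NOT Clay.
HONEST DEPENDENCY (b2b cell, verbatim): «continuum YM on T⁴ ⇐ BetaPertH ∧ nine spine estimates (0/9 proved); BetaPertH ⇐ (D1) ∧ (D4) ∧ CAP+tail; G-an2-4 gates asym, D1 and NE2/3/4.»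

WHY (census row 99 of `HOME/g1/RESIDUE.md`): the limit face of row 98 — what a by-value desk reads (the real part of `vᵀK̂_j(h·k)v ∕ h²` for small `h`) IS the Plücker form of the level-`j`
(1.22) matrix; at `JsRowD1Pin` with NO hypothesis.  WHAT IT IS NOT: no certificate; hW ∕ hR (pinned ∕ (III′)), the VALUE side of (D1), (1.21), `D1Tel` ∕ `D1Rep` untouched; words unchanged.

CONTENT (all [folklore]; no `def`, 0 sorry): §4 **`tendsto_form_cos_div_sq_pluecker`**, **`secondMoment_nonneg_of_eventually_form_cos_nonneg`**; §4b `re_symbolForm_real` (dictionary: for a REAL test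
vector row 94's real-coordinate symbol form is the cosine form), **`secondMoment_nonneg_of_symbol_re_nonneg_near_zero`** (row 94's certificate in a PUNCTURED NEIGHBOURHOOD of `k = 0` ⟹ all
`β_{ab} ≥ 0`: `ConvPSD` on the whole dual torus is not needed for Lemma 5.2's conclusion); §5 literals (`d = 4`): `tsum_form_cos_flipK`, **`tendsto_form_cos_div_sq_pluecker_JsRowD1Pin`**,
**`secondMoment_TbalOf_JsRowD1Pin_nonneg_of_eventually_form_cos_nonneg`**, `symbolEntry_flipK_realCoord`, **`secondMoment_TbalOf_JsRowD1Pin_nonneg_of_symbol_re_nonneg_near_zero`** (all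
hypothesis-free), `tendsto_form_cos_div_sq_pluecker_JsBalAn1`, `tendsto_form_cos_div_sq_pluecker_JsB12CombShSym` (under `hW_j ∧ hR_j`).

Provenance: cell pub-balaban-gaps, seat g1-p1 GEN 19 (prover-pub-balaban-gaps-g1-p1-g19-0), 2026-08-26 (INTENT-76); imports this seat's rows 97 ∕ 98 (`Gaps/D1SymbolTraceGerm`, `Gaps/D1ReflectionSecondMoments`);
no existing file touched.
-/

noncomputable section

open Complex Finset Filter Topology
open scoped ComplexConjugate BigOperators Real

namespace Summit.QuantumFields.BalabanUV.Gaps.D1SymbolPlueckerGerm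

open Literature.MathematicalPhysics.QuantumFieldTheory.Balaban1983to89
open Literature.MathematicalPhysics.QuantumFieldTheory.Balaban1983to89.Beta.PolarizationSign (WardTransversal IndexSymmetric AxisReflectionCovariant MomentSummable)
open Summit.QuantumFields.BalabanUV.Gaps.D1SymbolTraceGerm (tendsto_form_cos_div_sq)
open Summit.QuantumFields.BalabanUV.Gaps.D1ReflectionSecondMoments (germ_eq_pluecker germ_nonneg_iff)
open Summit.QuantumFields.BalabanUV.Gaps.D1SymbolSmallMomentumGerm (re_symbolEntry_eq_tsum_cos)

variable {d : ℕ}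

/-! ## §4 The limit statement: the quadratic germ of `Re vᵀ P̂(s·k) v` -/

/-- [folklore] **(5.16) TO SECOND ORDER, CHANNEL BY CHANNEL, AS A LIMIT**: under (5.7)–(5.9) + summable third moments, for every real `v` and direction `k`,
`(Σ_z (Σ_{μν} v_μ v_ν P_{μν}(z)) cos(p k·z)) ∕ p² → ½ Σ_{μ≠ν} β_{μν} (v_μ k_ν − v_ν k_μ)²` as `p → 0`, `p ≠ 0` — the numerator being `Re vᵀP̂(k∕2π·p)v` (row 95's `re_symbolEntry_eq_tsum_cos`). -/
theorem tendsto_form_cos_div_sq_pluecker {P : B12Beta.Kernel d} (hP : MomentSummable P 3) (hT : WardTransversal P) (hS : IndexSymmetric P) (hR : AxisReflectionCovariant P) (v k : Fin d → ℝ) :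
    Tendsto (fun p : ℝ => (∑' z, (∑ μ, ∑ ν, v μ * v ν * P μ ν z) * Real.cos (p * ∑ i, k i * z i)) / p ^ 2) (𝓝[≠] 0)
      (𝓝 ((1 / 2) * ∑ μ, ∑ ν, if μ = ν then 0 else B12Beta.secondMoment P μ ν * (v μ * k ν - v ν * k μ) ^ 2)) := by
  rw [← germ_eq_pluecker hP hT hS hR]; exact tendsto_form_cos_div_sq hP hT v k

/-- [folklore] **NEAR-ZERO-MOMENTUM POSITIVITY OF THE SYMBOL ON REAL VECTORS FORCES ALL SIX (1.22) SIGNS**: if for every real `v` and direction `k` the cosine form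
`Σ_z (Σ v_μ v_ν P_{μν}(z)) cos(p k·z)` is `≥ 0` for all small `p ≠ 0`, then `0 ≤ β_{ab}` for every `a ≠ b`. (The converse holds termwise at second order — `germ_nonneg_iff` — but not
beyond: where the Plücker form vanishes, `v ∥ k`, higher orders decide.) -/
theorem secondMoment_nonneg_of_eventually_form_cos_nonneg {P : B12Beta.Kernel d} (hP : MomentSummable P 3) (hT : WardTransversal P) (hS : IndexSymmetric P) (hR : AxisReflectionCovariant P)
    (h : ∀ v k : Fin d → ℝ, ∀ᶠ p in 𝓝[≠] (0 : ℝ), 0 ≤ ∑' z, (∑ μ, ∑ ν, v μ * v ν * P μ ν z) * Real.cos (p * ∑ i, k i * z i)) {a b : Fin d} (hab : a ≠ b) :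
    0 ≤ B12Beta.secondMoment P a b := by
  refine (germ_nonneg_iff hP hT hS hR).mp (fun v k => ?_) a b hab
  have hlim := tendsto_form_cos_div_sq hP hT v k
  exact ge_of_tendsto hlim ((h v k).mono fun p hp => div_nonneg hp (sq_nonneg p))

/-! ## §4b Row 94's real-coordinate certificate, restricted to a punctured neighbourhood of `k = 0`, already forces the six signs -/

/-- [folklore] DICTIONARY: for a REAL test vector `x`, row 94's real-coordinate symbol form at momentum `k` is the cosine form `Σ_z (Σ_{μν} x_μ x_ν P_{μν}(z)) cos(2π k·z)`. -/
theorem re_symbolForm_real {P : B12Beta.Kernel d} (hP : MomentSummable P 3) (x k : Fin d → ℝ) :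
    (∑ μ, ∑ ν, conj ((x μ : ℂ)) * (∑' z, (P μ ν z : ℂ) * cexp (-(2 * π * I) * ∑ i, (k i : ℂ) * (z i : ℂ))) * (x ν : ℂ)).re
      = ∑' z, (∑ μ, ∑ ν, x μ * x ν * P μ ν z) * Real.cos (2 * π * ∑ i, k i * z i) := by
  have hcos : ∀ μ ν, Summable fun z => x μ * x ν * (P μ ν z * Real.cos (2 * π * ∑ i, k i * z i)) := fun μ ν => by
    have h0 : Summable fun z => P μ ν z * Real.cos (2 * π * ∑ i, k i * z i) :=
      Summable.of_norm_bounded (hP.summable_abs μ ν) fun z => by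
        rw [Real.norm_eq_abs, abs_mul]; exact mul_le_of_le_one_right (abs_nonneg _) (Real.abs_cos_le_one _)
    exact h0.mul_left _
  rw [Complex.re_sum]
  simp_rw [Complex.re_sum, Complex.conj_ofReal]
  have e : ∀ μ ν, ((x μ : ℂ) * (∑' z, (P μ ν z : ℂ) * cexp (-(2 * π * I) * ∑ i, (k i : ℂ) * (z i : ℂ))) * (x ν : ℂ)).re
      = x μ * x ν * ∑' z, P μ ν z * Real.cos (2 * π * ∑ i, k i * z i) := by
    intro μ ν
    set E := (∑' z, (P μ ν z : ℂ) * cexp (-(2 * π * I) * ∑ i, (k i : ℂ) * (z i : ℂ))) with hEdef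
    rw [show (x μ : ℂ) * E * (x ν : ℂ) = ((x μ * x ν : ℝ) : ℂ) * E by push_cast; ring, Complex.re_ofReal_mul, hEdef,
      re_symbolEntry_eq_tsum_cos (fun μ ν => hP.summable_abs μ ν) μ ν k]
  simp_rw [e]
  symm
  calc ∑' z, (∑ μ, ∑ ν, x μ * x ν * P μ ν z) * Real.cos (2 * π * ∑ i, k i * z i) = ∑' z, ∑ μ, ∑ ν, x μ * x ν * (P μ ν z * Real.cos (2 * π * ∑ i, k i * z i)) :=
        tsum_congr fun z => by
          rw [Finset.sum_mul]; refine Finset.sum_congr rfl fun μ _ => ?_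
          rw [Finset.sum_mul]; exact Finset.sum_congr rfl fun ν _ => by ring
    _ = ∑ μ, ∑' z, ∑ ν, x μ * x ν * (P μ ν z * Real.cos (2 * π * ∑ i, k i * z i)) := Summable.tsum_finsetSum fun μ _ => summable_sum fun ν _ => hcos μ ν
    _ = ∑ μ, ∑ ν, ∑' z, x μ * x ν * (P μ ν z * Real.cos (2 * π * ∑ i, k i * z i)) := Finset.sum_congr rfl fun μ _ => Summable.tsum_finsetSum fun ν _ => hcos μ ν
    _ = ∑ μ, ∑ ν, x μ * x ν * ∑' z, P μ ν z * Real.cos (2 * π * ∑ i, k i * z i) := by simp_rw [tsum_mul_left]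

/-- [folklore] **ROW 94's CERTIFICATE IN A PUNCTURED NEIGHBOURHOOD OF ZERO MOMENTUM ALREADY GIVES LEMMA 5.2's CONCLUSION**: under (5.7)–(5.9) + summable third moments, if for every direction `k`
and every (complex) `v` the real-coordinate symbol form of row 94 at momentum `s·k` is `≥ 0` for all small `s ≠ 0`, then `0 ≤ β_{ab}` for every `a ≠ b` — `ConvPSD` on all of `(ℝ∕ℤ)^d` is not
needed for the sign; only real test vectors are used. -/
theorem secondMoment_nonneg_of_symbol_re_nonneg_near_zero {P : B12Beta.Kernel d} (hP : MomentSummable P 3) (hT : WardTransversal P) (hS : IndexSymmetric P) (hR : AxisReflectionCovariant P)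
    (h : ∀ (k : Fin d → ℝ) (v : Fin d → ℂ), ∀ᶠ s in 𝓝[≠] (0 : ℝ),
      0 ≤ (∑ μ, ∑ ν, conj (v μ) * (∑' z, (P μ ν z : ℂ) * cexp (-(2 * π * I) * ∑ i, ((s * k i : ℝ) : ℂ) * (z i : ℂ))) * v ν).re)
    {a b : Fin d} (hab : a ≠ b) : 0 ≤ B12Beta.secondMoment P a b := by
  refine secondMoment_nonneg_of_eventually_form_cos_nonneg hP hT hS hR (fun x k => ?_) hab
  -- read the hypothesis at the real vector `x` and direction `k ∕ 2π`, i.e. momentum `s·k∕2π`, so that `2π (s k∕2π)·z = s k·z`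
  have hx := h (fun i => k i / (2 * π)) (fun μ => (x μ : ℂ))
  filter_upwards [hx] with s hs
  rw [re_symbolForm_real hP x] at hs
  have e : ∀ z : Fin d → ℤ, 2 * π * ∑ i, s * (k i / (2 * π)) * (z i : ℝ) = s * ∑ i, k i * z i := by
    intro z
    rw [Finset.mul_sum, Finset.mul_sum]
    exact Finset.sum_congr rfl fun i _ => by field_simp
  simpa only [e] using hs

/-! ## §5 At the row-(D1) literals (`d = 4`): the germ of the level-`j` symbol form is the Plücker form of the level-`j` (1.22) matrix `β⁰_j(a,b)` -/

section Literals

open Literature.MathematicalPhysics.QuantumFieldTheory.Balaban1983to89.Beta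
open OneStepResolventKernel (JetData)
open OneStepKernelFamily (TbalOf flipK flipK_apply secondMoment_flipK)
open Summit.QuantumFields.BalabanUV.Beta.MixedJetTablesPlug (JsBalAn1)
open Summit.QuantumFields.BalabanUV.Beta.CombChartJointEnd (JsB12CombShSym)
open Summit.QuantumFields.BalabanUV.Beta.SymmetrisedStepJets (SymTables)
open Summit.QuantumFields.BalabanUV.Beta.RowD1JointEnd (JsRowD1Pin)
open Summit.QuantumFields.BalabanUV.Beta.RowD1SymmetriesDischarged (symmetries_JsRowD1Pin)
open Summit.QuantumFields.BalabanUV.Gaps.D1IndexSymmetryDictionary (momentSummable_flipK_TbalOf)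
open Summit.QuantumFields.BalabanUV.Gaps.D1PinnedIndexSymmetry (indexSymmetric_flipK_TbalOf_JsBalAn1)
open Summit.QuantumFields.BalabanUV.Gaps.D1RecordIndexSymmetry (indexSymmetric_flipK_TbalOf_JsB12CombShSym)
open Summit.QuantumFields.BalabanUV.Gaps.D1CoDressedLongitudinalForm (indexSymmetric_flipK_TbalOf_JsRowD1Pin)

/-- [folklore] The cosine form is blind to the flip `z ↦ −z`. -/
theorem tsum_form_cos_flipK (T : B12Beta.Kernel d) (v k : Fin d → ℝ) (p : ℝ) :
    ∑' z, (∑ μ, ∑ ν, v μ * v ν * flipK T μ ν z) * Real.cos (p * ∑ i, k i * z i) = ∑' z, (∑ μ, ∑ ν, v μ * v ν * T μ ν z) * Real.cos (p * ∑ i, k i * z i) := by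
  rw [← (Equiv.neg (Fin d → ℤ)).tsum_eq (fun z => (∑ μ, ∑ ν, v μ * v ν * T μ ν z) * Real.cos (p * ∑ i, k i * z i))]
  refine tsum_congr fun z => ?_
  simp only [flipK_apply, Equiv.neg_apply, Pi.neg_apply, Int.cast_neg, mul_neg, Finset.sum_neg_distrib, Real.cos_neg]

variable {Lc : ℕ} [NeZero Lc]

/-- [folklore] **AN2's CHART-(II) LITERAL `JsRowD1Pin hLc N` (`Odd Lc`, `2 ≤ N`), HYPOTHESIS-FREE — (5.16) TO SECOND ORDER WITH THE LEVEL-`j` (1.22) MATRIX**: with `T_j := TbalOf Lc (JsRowD1Pin hLc N) j`,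
for every real `v`, `k`: `(Σ_z (Σ_{μν} v_μ v_ν T_j(μ,ν,z)) cos(p k·z)) ∕ p² → ½ Σ_{μ≠ν} β⁰_j(μ,ν) (v_μ k_ν − v_ν k_μ)²` (hW, hR, (5.8) are THEOREMS there: an2's `symmetries_JsRowD1Pin`, row 87). -/
theorem tendsto_form_cos_div_sq_pluecker_JsRowD1Pin (hLc : Odd Lc) {N : ℕ} (hN : 2 ≤ N) (j : ℕ) (v k : Fin 4 → ℝ) :
    Tendsto (fun p : ℝ => (∑' z, (∑ μ, ∑ ν, v μ * v ν * TbalOf Lc (JsRowD1Pin hLc N) j μ ν z) * Real.cos (p * ∑ i, k i * z i)) / p ^ 2) (𝓝[≠] 0)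
      (𝓝 ((1 / 2) * ∑ μ, ∑ ν, if μ = ν then 0 else B12Beta.secondMoment (TbalOf Lc (JsRowD1Pin hLc N) j) μ ν * (v μ * k ν - v ν * k μ) ^ 2)) := by
  have h := tendsto_form_cos_div_sq_pluecker (momentSummable_flipK_TbalOf _ j 3) ((symmetries_JsRowD1Pin hLc hN).1 j) (indexSymmetric_flipK_TbalOf_JsRowD1Pin hLc N j)
    ((symmetries_JsRowD1Pin hLc hN).2 j) v k
  simpa only [tsum_form_cos_flipK, secondMoment_flipK] using h

/-- [folklore] **… hence at `JsRowD1Pin`: near-zero-momentum positivity of the real symbol form at level `j` ⟹ all six `β⁰_j(a,b) ≥ 0`, NO OTHER HYPOTHESIS.** -/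
theorem secondMoment_TbalOf_JsRowD1Pin_nonneg_of_eventually_form_cos_nonneg (hLc : Odd Lc) {N : ℕ} (hN : 2 ≤ N) (j : ℕ)
    (h : ∀ v k : Fin 4 → ℝ, ∀ᶠ p in 𝓝[≠] (0 : ℝ), 0 ≤ ∑' z, (∑ μ, ∑ ν, v μ * v ν * TbalOf Lc (JsRowD1Pin hLc N) j μ ν z) * Real.cos (p * ∑ i, k i * z i))
    {a b : Fin 4} (hab : a ≠ b) : 0 ≤ B12Beta.secondMoment (TbalOf Lc (JsRowD1Pin hLc N) j) a b := by
  rw [← secondMoment_flipK]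
  refine secondMoment_nonneg_of_eventually_form_cos_nonneg (momentSummable_flipK_TbalOf _ j 3) ((symmetries_JsRowD1Pin hLc hN).1 j) (indexSymmetric_flipK_TbalOf_JsRowD1Pin hLc N j)
    ((symmetries_JsRowD1Pin hLc hN).2 j) (fun v k => ?_) hab
  simpa only [tsum_form_cos_flipK] using h v k

/-- [folklore] The real-coordinate symbol entry of `flipK T` at momentum `c` is that of `T` at `−c` (re-index `z ↦ −z`). -/
theorem symbolEntry_flipK_realCoord (T : B12Beta.Kernel d) (μ ν : Fin d) (c : Fin d → ℝ) :
    ∑' z, (flipK T μ ν z : ℂ) * cexp (-(2 * π * I) * ∑ i, (c i : ℂ) * (z i : ℂ)) = ∑' z, (T μ ν z : ℂ) * cexp (-(2 * π * I) * ∑ i, ((-c i : ℝ) : ℂ) * (z i : ℂ)) := by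
  rw [← (Equiv.neg (Fin d → ℤ)).tsum_eq (fun z => (T μ ν z : ℂ) * cexp (-(2 * π * I) * ∑ i, ((-c i : ℝ) : ℂ) * (z i : ℂ)))]
  refine tsum_congr fun z => ?_
  simp only [flipK_apply, Equiv.neg_apply, Pi.neg_apply, Int.cast_neg, Complex.ofReal_neg, mul_neg, neg_mul, neg_neg]

/-- [folklore] **AT `JsRowD1Pin`, ROW 94's REAL-COORDINATE CERTIFICATE FOR THE UNFLIPPED TABLE `T_j` IN A PUNCTURED NEIGHBOURHOOD OF `k = 0` GIVES ALL SIX `β⁰_j(a,b) ≥ 0` — NO OTHER HYPOTHESIS**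
(`Odd Lc`, `2 ≤ N`): if for every direction `k` and every `v ∈ ℂ⁴`, `0 ≤ Re Σ_{μν} conj(v_μ) (Σ_z T_j(μ,ν,z) e^{−2πi s k·z}) v_ν` for all small `s ≠ 0`, then `0 ≤ β⁰_j(a,b)` for `a ≠ b`. -/
theorem secondMoment_TbalOf_JsRowD1Pin_nonneg_of_symbol_re_nonneg_near_zero (hLc : Odd Lc) {N : ℕ} (hN : 2 ≤ N) (j : ℕ)
    (h : ∀ (k : Fin 4 → ℝ) (v : Fin 4 → ℂ), ∀ᶠ s in 𝓝[≠] (0 : ℝ),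
      0 ≤ (∑ μ, ∑ ν, conj (v μ) * (∑' z, (TbalOf Lc (JsRowD1Pin hLc N) j μ ν z : ℂ) * cexp (-(2 * π * I) * ∑ i, ((s * k i : ℝ) : ℂ) * (z i : ℂ))) * v ν).re)
    {a b : Fin 4} (hab : a ≠ b) : 0 ≤ B12Beta.secondMoment (TbalOf Lc (JsRowD1Pin hLc N) j) a b := by
  rw [← secondMoment_flipK]
  refine secondMoment_nonneg_of_symbol_re_nonneg_near_zero (momentSummable_flipK_TbalOf _ j 3) ((symmetries_JsRowD1Pin hLc hN).1 j) (indexSymmetric_flipK_TbalOf_JsRowD1Pin hLc N j)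
    ((symmetries_JsRowD1Pin hLc hN).2 j) (fun k v => ?_) hab
  simp_rw [symbolEntry_flipK_realCoord]
  have h' := h (fun i => -k i) v
  refine h'.mono fun s hs => ?_
  simpa only [mul_neg] using hs

variable {r : Fin (3 + 1) → ℕ}

/-- [folklore] **THE β-LEAD's PINNED FAMILY `JsBalAn1 …` UNDER THE END's TWO SYMMETRY BINDERS `hW_j ∧ hR_j`** (any `1 ≤ Lc`, root, colours, `cE₂`, `cB`, `T`; (5.8) a theorem, GEN 14):
the level-`j` symbol form has the Plücker germ `½ Σ_{μ≠ν} β⁰_j(μ,ν) (v_μ k_ν − v_ν k_μ)²`. -/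
theorem tendsto_form_cos_div_sq_pluecker_JsBalAn1 (hLc : 1 ≤ Lc) (hr : r ∈ AffineAveraging.box (3 + 1) Lc) (cE cVH cΛ cE₂ cB : ℝ) (T : Fin 4 → Fin 4 → Fin 4 → Fin 4 → ℝ) (j : ℕ)
    (hW : WardTransversal (flipK (TbalOf Lc (JsBalAn1 hLc hr cE cVH cΛ cE₂ cB T) j))) (hRj : AxisReflectionCovariant (flipK (TbalOf Lc (JsBalAn1 hLc hr cE cVH cΛ cE₂ cB T) j)))
    (v k : Fin 4 → ℝ) :
    Tendsto (fun p : ℝ => (∑' z, (∑ μ, ∑ ν, v μ * v ν * TbalOf Lc (JsBalAn1 hLc hr cE cVH cΛ cE₂ cB T) j μ ν z) * Real.cos (p * ∑ i, k i * z i)) / p ^ 2) (𝓝[≠] 0)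
      (𝓝 ((1 / 2) * ∑ μ, ∑ ν, if μ = ν then 0 else B12Beta.secondMoment (TbalOf Lc (JsBalAn1 hLc hr cE cVH cΛ cE₂ cB T) j) μ ν * (v μ * k ν - v ν * k μ) ^ 2)) := by
  have h := tendsto_form_cos_div_sq_pluecker (momentSummable_flipK_TbalOf _ j 3) hW (indexSymmetric_flipK_TbalOf_JsBalAn1 hLc hr cE cVH cΛ cE₂ cB T j) hRj v k
  simpa only [tsum_form_cos_flipK, secondMoment_flipK] using h

/-- [folklore] **THE b2b WALL's (III′) LITERAL `JsB12CombShSym hLc N tabs cΛ cB` UNDER `hW_j ∧ hR_j`** (every table record; `Odd Lc`; (5.8) a theorem, GEN 14): the level-`j` symbol form has the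
Plücker germ `½ Σ_{μ≠ν} β⁰_j(μ,ν) (v_μ k_ν − v_ν k_μ)²`. -/
theorem tendsto_form_cos_div_sq_pluecker_JsB12CombShSym (hLc : Odd Lc) (N : ℕ) (tabs : SymTables 3 Lc) (cΛ cB : ℝ) (j : ℕ)
    (hW : WardTransversal (flipK (TbalOf Lc (JsB12CombShSym hLc N tabs cΛ cB) j))) (hRj : AxisReflectionCovariant (flipK (TbalOf Lc (JsB12CombShSym hLc N tabs cΛ cB) j)))
    (v k : Fin 4 → ℝ) :
    Tendsto (fun p : ℝ => (∑' z, (∑ μ, ∑ ν, v μ * v ν * TbalOf Lc (JsB12CombShSym hLc N tabs cΛ cB) j μ ν z) * Real.cos (p * ∑ i, k i * z i)) / p ^ 2) (𝓝[≠] 0)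
      (𝓝 ((1 / 2) * ∑ μ, ∑ ν, if μ = ν then 0 else B12Beta.secondMoment (TbalOf Lc (JsB12CombShSym hLc N tabs cΛ cB) j) μ ν * (v μ * k ν - v ν * k μ) ^ 2)) := by
  have h := tendsto_form_cos_div_sq_pluecker (momentSummable_flipK_TbalOf _ j 3) hW (indexSymmetric_flipK_TbalOf_JsB12CombShSym hLc N tabs cΛ cB j) hRj v k
  simpa only [tsum_form_cos_flipK, secondMoment_flipK] using h

end Literals

end Summit.QuantumFields.BalabanUV.Gaps.D1SymbolPlueckerGerm
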